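import Summits.QuantumFields.YangMills.Theorems.BalabanUVNodesN22W1StripTermIndexed

/-!
# BalabanUVNodes ∕ node N22 = NE9 — THE STRIP INDUCTION AT THE W1 OBJECT, MODULE 26′ (HONESTY RIDER): WHAT THE UNIFORM-DISC CLAUSE OF THE PER-TERM
# LAST-COUPLING SCHEMA (S-last-T) OF 22′ ∕ 24′ ∕ 25′ SAYS AT ZERO COUPLING — a located self-audit of this lineage's last-coupling currency, kernel-checked

Cell `pub-ymgap`, HUMAN RULING D-0062 (Track A), R134 ACCELERATION re-seat `pub-ymgap-dag-n22-c` (strategy s1), generation 6.  THEOREMS ONLY; imports module 22′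
`…N22W1StripTermIndexed` (the clause lives at `stepSchemaLast_ofTerms_of_termwise` :134; modules 24′ §1–§3 and 25′ §1–§3 inherit it as `hlastT`).  `--supports` K3⁗
`SpineGivenEndpointR13Sep` (stmt-QuantumFields-20292) as a helper.  The complex-analysis facts of §1–§2 are RE-PROVED (verbatim up to names) from the planner lens's
farm-checked sketch `run/shared/lean/pub/pub-ymgap/ym-lens-BalabanUVNodes-transfer/lean/LensTransferSketch7.lean` (sha16 d9d46c9c43972024, namespace `YMLens.Transfer7`, cards
T12a–T12c of `LENS-transfer.md` §13.2; the lens seat files nothing by design) — attribution, not authorship, is this seat's.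

WHY (LOCATED, this seat's g6 self-audit; nothing landed is false).  The per-term last-coupling schema (S-last-T) displayed by 22′ `stepSchemaLast_ofTerms_of_termwise`, 24′ and 25′
(`hlastT`), like the level schema (S-last) of 18′ ∕ 21′ and the `EHoloAt`-fed STRIP of 14′ §3–§4, asks for ONE open set `U` containing the closed disc `closedBall (t : ℂ) r` about
EVERY window coupling `t ∈ ]0, γ]`, with the radius `r = li.r` FIXED.  Such a `U` contains the open ball `ball 0 r` about ZERO COUPLING (§1 `ball_zero_subset_of_lastDiscs`):
the schema's holomorphy clause is therefore analyticity of the (2.14) term AT `g = 0` with geometric Taylor bounds (§3 `analyticAt_zero_of_stepSchemaLastT`) — the TYPE of the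
`γ_k`-variant of the small-field cut-off ([I] p. 266 «Another possibility is to take `g_k∕γ_k ε₁` instead of `ε₁` … the functions `E^{(j)}`, `β_j` are analytic functions of the effective
coupling constants»), whereas NODE 00's record keys possibility 1 of (2.9) — thresholds `ε₁` on `B′ = g_k⁻¹B`, i.e. `ε₁∕g_k` on the Gaussian variable ([I] p. 267 «we make the scaling
transformation», p. 268; def-B13 `ResidB13K.rP := c.ε₁∕‖g‖`), for which print claims only «a C^∞-function of `g_{j−1} ∈ [0, γ]`, (or analytic)» ([I] p. 263).  Worse, the clause is
RIGID: a term functional reading the coupling through ANY real threshold law `ρ` and a strictly monotone real response `G` (a Gaussian box mass), `TF … s … = G (ρ s)`, meets the clause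
only with `ρ` CONSTANT on `[0, γ]` (§3 `thresholdLaw_frozen_of_stepSchemaLastT`, open-mapping theorem), and a modulus-keyed one only as a coupling-CONSTANT (§3
`modulusKeyed_const_of_stepSchemaLastT`).  So under the χ-species of record the schema is inhabited only coupling-blind — this lineage's own rider 24′ `termSchemas_zeroTermFun` is the
degenerate inhabitant.  The leaves 22′–25′ stay TRUE implications; their last-coupling hypothesis is located-vacuous for the term of record.  The print-faithful RE-TYPING (RELATIVE discs
`closedBall (t : ℂ) (c·t)` with a CENTRED order-two letter, the tree's road `N22KnitVertexCentered` at `p = 2`; this seat's files F0–F2 of generation 6) is NOT in this file.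

WHAT.
* §1 geometry of the clause: `ball_zero_subset_of_lastDiscs`, `zero_mem_of_lastDiscs`, `analyticAt_zero_of_lastDiscs`, `taylorBound_of_lastDiscs` (`‖f⁽ⁿ⁾(s)‖ ≤ n!·W∕(r∕2)ⁿ` on
  `[0, γ]`), `rect_of_lastDiscs` (an open convex neighbourhood of `[0, γ]` inside `U`).
* §2 rigidity: `realValued_eqOn_const` (holomorphic + real-valued ⇒ constant), `thresholdLaw_frozen` ∕ `thresholdLaw_frozen_of_lastDiscs`, `radial_eqOn_const`,
  `modulusKeyed_const_of_lastDiscs`, `not_lastDiscs_invNorm` (the law `z ↦ ε₁∕‖z‖` itself fails the clause), `lastDiscs_of_couplingBlind` (exit (α)).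
* §3 AT THE CLAUSE OF 22′ :134 VERBATIM (one step `k′`, one older-terms family `old`): `analyticAt_zero_of_stepSchemaLastT` (analytic at `0` + Taylor bounds with
  `W := weight(t)·e^{a₅|Z|}`), `thresholdLaw_frozen_of_stepSchemaLastT`, `modulusKeyed_const_of_stepSchemaLastT`.

HONEST FRAMING.  Count-neutral honesty rider; negative knowledge about a HYPOTHESIS SHAPE of this seat's own leaves; nothing of Bałaban's asserted; no theorem of the tree refuted
(the leaves are implications); N22 NOT discharged; NE9 NOT PRINTED for d = 4; one finite four-torus programme at fixed ε — NOT infinite volume, NOT OS on ℝ⁴, NOT a mass gap, NOT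
Clay.  0 `sorry`, 0 `def`, standard axioms.

References (TYPES and page anchors only): [I] = [Balaban1987RG1] p. 263 (C^∞ «(or analytic)»), (2.9) p. 266 (the two cut-offs), p. 267–268 (the scaling `B = g_kB′`, (2.13)
«vanishes at `g_k = 0`»); [II] = [Balaban1988RG2Cluster] (2.3) p. 12, (2.14) p. 15, (2.26) p. 17.
-/

noncomputable section

namespace YMDAG.N22.W1

open Set Metric Filter Complex
open scoped BigOperators Topology
open Literature.MathematicalPhysics.QuantumFieldTheory.Balaban1983to89
open Literature.MathematicalPhysics.QuantumFieldTheory.Balaban1983to89.T4Continuum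
open Literature.MathematicalPhysics.QuantumFieldTheory.Balaban1983to89.TreeLengthTorus (TPt TDom tsys torusTreeLen torusTreeLen_nonneg)
open Literature.MathematicalPhysics.QuantumFieldTheory.Balaban1983to89.B13Lemma3TorusData (TBond)
open Literature.MathematicalPhysics.QuantumFieldTheory.Balaban1983to89.B13Lemma3TorusTerms (terms weight weight_nonneg)
open Literature.MathematicalPhysics.QuantumFieldTheory.Balaban1983to89.Step (SFConsts)
open Literature.MathematicalPhysics.QuantumFieldTheory.Balaban1983to89.Node00.Sect2 (domSys domCount CPair spaceI domSites Setting Residual)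
open Literature.MathematicalPhysics.QuantumFieldTheory.Balaban1983to89.Node00.W1

/-! ## §1 The geometry of the uniform-disc clause: it contains a neighbourhood of zero coupling -/

/-- **THE CLAUSE REACHES ZERO COUPLING**: closed `r`-discs about every `t ∈ ]0, γ]` cover the open `r`-ball about `0` (take `t = min(γ, (r − |z|)∕2)`).  Adapted from the lens sketch
`YMLens.Transfer7.ball_zero_subset_of_discs`. [cite: Balaban1987RG1, §1 p.263 and (2.9) p.266] -/
theorem ball_zero_subset_of_lastDiscs {γ r : ℝ} (hγ : 0 < γ) {U : Set ℂ} (h : ∀ t ∈ Ioc (0 : ℝ) γ, closedBall (t : ℂ) r ⊆ U) : ball (0 : ℂ) r ⊆ U := by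
  intro z hz
  rw [mem_ball, dist_zero_right] at hz
  set t : ℝ := min γ ((r - ‖z‖) / 2) with ht
  have htpos : 0 < t := lt_min hγ (by linarith)
  refine h t ⟨htpos, min_le_left _ _⟩ ?_
  rw [mem_closedBall, dist_eq_norm]
  calc ‖z - (t : ℂ)‖ ≤ ‖z‖ + ‖(t : ℂ)‖ := norm_sub_le _ _
    _ = ‖z‖ + t := by rw [Complex.norm_real, Real.norm_eq_abs, abs_of_pos htpos]
    _ ≤ r := by linarith [min_le_right γ ((r - ‖z‖) / 2)]

/-- Zero coupling lies in the clause's open set. [cite: Balaban1987RG1, §1 p.263] -/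
theorem zero_mem_of_lastDiscs {γ r : ℝ} (hγ : 0 < γ) (hr : 0 < r) {U : Set ℂ} (h : ∀ t ∈ Ioc (0 : ℝ) γ, closedBall (t : ℂ) r ⊆ U) : (0 : ℂ) ∈ U :=
  ball_zero_subset_of_lastDiscs hγ h (mem_ball_self hr)

/-- **HOLOMORPHY ON THE CLAUSE's `U` IS ANALYTICITY AT ZERO COUPLING.**  Adapted from `YMLens.Transfer7.analyticAt_zero_of_discClause`. [cite: Balaban1987RG1, §1 p.263 and (2.9) p.266] -/
theorem analyticAt_zero_of_lastDiscs {γ r : ℝ} (hγ : 0 < γ) (hr : 0 < r) {f : ℂ → ℂ} {U : Set ℂ} (hU : ∀ t ∈ Ioc (0 : ℝ) γ, closedBall (t : ℂ) r ⊆ U)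
    (hf : DifferentiableOn ℂ f U) : AnalyticAt ℂ f 0 :=
  hf.analyticAt (mem_of_superset (ball_mem_nhds 0 hr) (ball_zero_subset_of_lastDiscs hγ hU))

/-- **GEOMETRIC TAYLOR BOUNDS ON `[0, γ]`, ZERO COUPLING INCLUDED**: under the clause and a uniform bound `‖f‖ ≤ W` on `U`, Cauchy's estimate on the `(r∕2)`-circles gives
`‖f⁽ⁿ⁾(s)‖ ≤ n!·W∕(r∕2)ⁿ` at every `s ∈ [0, γ]` — convergent perturbation theory of the term at `g = 0`, the content print does NOT state under possibility 1 of [I] (2.9).  Adapted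
from `YMLens.Transfer7.taylorBound_of_discClause`. [cite: Balaban1987RG1, §1 p.263 and (2.9) p.266] -/
theorem taylorBound_of_lastDiscs {γ r W : ℝ} (hγ : 0 < γ) (hr : 0 < r) {f : ℂ → ℂ} {U : Set ℂ} (hU : ∀ t ∈ Ioc (0 : ℝ) γ, closedBall (t : ℂ) r ⊆ U)
    (hf : DifferentiableOn ℂ f U) (hW : ∀ z ∈ U, ‖f z‖ ≤ W) : ∀ s ∈ Icc (0 : ℝ) γ, ∀ n : ℕ, ‖iteratedDeriv n f s‖ ≤ n.factorial * W / (r / 2) ^ n := by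
  intro s hs n
  have hr2 : 0 < r / 2 := by linarith
  have hsub : closedBall (s : ℂ) (r / 2) ⊆ U := by
    rcases eq_or_lt_of_le hs.1 with h0 | hpos
    · rw [← h0, Complex.ofReal_zero]
      exact (closedBall_subset_ball (by linarith)).trans (ball_zero_subset_of_lastDiscs hγ hU)
    · exact (closedBall_subset_closedBall (by linarith)).trans (hU s ⟨hpos, hs.2⟩)
  exact Complex.norm_iteratedDeriv_le_of_forall_mem_sphere_norm_le n hr2 (hf.diffContOnCl_ball hsub) fun z hz => hW z (hsub (sphere_subset_closedBall hz))

/-- An open CONVEX neighbourhood of `[0, γ]` inside the clause's `U`: the rectangle `]-r∕2, γ+r∕2[ × ]-r∕2, r∕2[`, which contains every real point of `]-r∕2, γ+r∕2[`.  Adapted from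
`YMLens.Transfer7.rect_of_discs`. [cite: Balaban1987RG1, §1 p.263] -/
theorem rect_of_lastDiscs {γ r : ℝ} (hγ : 0 < γ) (hr : 0 < r) {U : Set ℂ} (hdisc : ∀ t ∈ Ioc (0 : ℝ) γ, closedBall (t : ℂ) r ⊆ U) :
    ∃ W : Set ℂ, IsOpen W ∧ Convex ℝ W ∧ W ⊆ U ∧ ∀ x : ℝ, -(r / 2) < x → x < γ + r / 2 → (x : ℂ) ∈ W := by
  refine ⟨({z : ℂ | -(r / 2) < z.re} ∩ {z : ℂ | z.re < γ + r / 2}) ∩ ({z : ℂ | -(r / 2) < z.im} ∩ {z : ℂ | z.im < r / 2}),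
    ((isOpen_lt continuous_const Complex.continuous_re).inter (isOpen_lt Complex.continuous_re continuous_const)).inter
      ((isOpen_lt continuous_const Complex.continuous_im).inter (isOpen_lt Complex.continuous_im continuous_const)),
    ((convex_halfSpace_re_gt _).inter (convex_halfSpace_re_lt _)).inter ((convex_halfSpace_im_gt _).inter (convex_halfSpace_im_lt _)), ?_,
    fun x hx1 hx2 => ⟨⟨by simpa using hx1, by simpa using hx2⟩, ⟨by simp; linarith, by simp; linarith⟩⟩⟩
  rintro z ⟨⟨h1, h2⟩, ⟨h3, h4⟩⟩
  simp only [mem_setOf_eq] at h1 h2 h3 h4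
  have key : ∀ x : ℝ, dist z (x : ℂ) ≤ |z.re - x| + |z.im| := fun x => by
    rw [dist_eq_norm]
    simpa [Complex.sub_re, Complex.sub_im, Complex.ofReal_re, Complex.ofReal_im] using Complex.norm_le_abs_re_add_abs_im (z - (x : ℂ))
  have him : |z.im| < r / 2 := abs_lt.mpr ⟨h3, h4⟩
  rcases le_or_gt z.re 0 with hz0 | hzpos
  · refine ball_zero_subset_of_lastDiscs hγ hdisc ?_
    rw [mem_ball]
    have h0 := key 0
    rw [Complex.ofReal_zero] at h0
    have hre : |z.re - 0| < r / 2 := by rw [sub_zero, abs_lt]; constructor <;> linarith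
    linarith
  rcases le_or_gt z.re γ with hzγ | hzbig
  · refine hdisc z.re ⟨hzpos, hzγ⟩ ?_
    rw [mem_closedBall]
    have h0 := key z.re
    rw [sub_self, abs_zero, zero_add] at h0
    linarith
  · refine hdisc γ ⟨hγ, le_rfl⟩ ?_
    rw [mem_closedBall]
    have h0 := key γ
    have hre : |z.re - γ| < r / 2 := by rw [abs_lt]; constructor <;> linarith
    linarith

/-! ## §2 Rigidity: real-valued and radial holomorphic functions are constant; threshold laws are frozen by the clause -/

/-- **REAL-VALUED RIGIDITY**: a holomorphic function on an open preconnected set taking only REAL values is constant there (open-mapping theorem).  Adapted from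
`YMLens.Transfer7.realValued_eqOn_const`. [folklore] -/
theorem realValued_eqOn_const {f : ℂ → ℂ} {U : Set ℂ} (hU : IsOpen U) (hUc : IsPreconnected U) (hd : DifferentiableOn ℂ f U) (hreal : ∀ z ∈ U, (f z).im = 0)
    {z₀ : ℂ} (hz₀ : z₀ ∈ U) : EqOn f (fun _ => f z₀) U := by
  have hfa : AnalyticOnNhd ℂ f U := hd.analyticOnNhd hU
  have hev : ∀ᶠ z in 𝓝 z₀, f z = f z₀ := by
    rcases (hfa z₀ hz₀).eventually_constant_or_nhds_le_map_nhds with h | h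
    · exact h
    · exfalso
      have hmem : {w : ℂ | w.im = 0} ∈ map f (𝓝 z₀) := by
        rw [Filter.mem_map]
        filter_upwards [hU.mem_nhds hz₀] with z hz using hreal z hz
      obtain ⟨ε, hε, hball⟩ := Metric.mem_nhds_iff.mp (h hmem)
      have hw : f z₀ + ((ε / 2 : ℝ) : ℂ) * I ∈ ball (f z₀) ε := by
        rw [mem_ball, dist_eq_norm, add_sub_cancel_left, norm_mul, Complex.norm_real, Complex.norm_I, mul_one, Real.norm_eq_abs, abs_of_pos (by linarith)]
        linarith
      have h1 := hball hw
      simp only [mem_setOf_eq, Complex.add_im, Complex.mul_im, Complex.ofReal_re, Complex.I_im, Complex.ofReal_im, Complex.I_re, mul_zero, mul_one, add_zero] at h1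
      have h0 := hreal z₀ hz₀
      linarith
  exact hfa.eqOn_of_preconnected_of_eventuallyEq analyticOnNhd_const hUc hz₀ hev

/-- **EVERY THRESHOLD LAW IS FROZEN BY HOLOMORPHY.**  If the coupling enters a term only through a real threshold `ρ(s)` read by a strictly monotone real response `G` (a Gaussian box
mass), `TF s = G (ρ s)`, then holomorphy of `TF` on an open preconnected `U` forces `ρ` to be CONSTANT on `U`.  Adapted from `YMLens.Transfer7.threshold_frozen`.
[cite: Balaban1988RG2Cluster, (2.3) p.12 (the thresholds `ε₁∕g_k`); Balaban1987RG1, (2.9) p.266] -/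
theorem thresholdLaw_frozen {ρ : ℂ → ℝ} {G : ℝ → ℝ} (hG : StrictMono G) {TF : ℂ → ℂ} (hTF : ∀ s, TF s = ((G (ρ s) : ℝ) : ℂ)) {U : Set ℂ} (hU : IsOpen U)
    (hUc : IsPreconnected U) (hd : DifferentiableOn ℂ TF U) {z₀ : ℂ} (hz₀ : z₀ ∈ U) : ∀ z ∈ U, ρ z = ρ z₀ := by
  intro z hz
  have h := realValued_eqOn_const hU hUc hd (fun w _ => by rw [hTF]; exact Complex.ofReal_im _) hz₀ hz
  simp only [hTF, Complex.ofReal_inj] at h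
  exact hG.injective h

/-- **… SO THE UNIFORM-DISC CLAUSE FREEZES EVERY THRESHOLD LAW ALONG `[0, γ]`** (equal to its value at zero coupling).  Adapted from `YMLens.Transfer7.threshold_frozen_of_discClause`.
[cite: Balaban1988RG2Cluster, (2.3) p.12; Balaban1987RG1, §1 p.263 and (2.9) p.266] -/
theorem thresholdLaw_frozen_of_lastDiscs {γ r : ℝ} (hγ : 0 < γ) (hr : 0 < r) {ρ : ℂ → ℝ} {G : ℝ → ℝ} (hG : StrictMono G) {TF : ℂ → ℂ}
    (hTF : ∀ s, TF s = ((G (ρ s) : ℝ) : ℂ)) {U : Set ℂ} (hdisc : ∀ t ∈ Ioc (0 : ℝ) γ, closedBall (t : ℂ) r ⊆ U) (hd : DifferentiableOn ℂ TF U) :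
    ∀ s ∈ Icc (0 : ℝ) γ, ρ s = ρ 0 := by
  obtain ⟨W, hWopen, hWconv, hWU, hreal⟩ := rect_of_lastDiscs hγ hr hdisc
  have h0W : ((0 : ℝ) : ℂ) ∈ W := hreal 0 (by linarith) (by linarith)
  intro s hs
  have h := thresholdLaw_frozen hG hTF hWopen hWconv.isPreconnected (hd.mono hWU) h0W (s : ℂ) (hreal s (by linarith [hs.1]) (by linarith [hs.2]))
  simpa using h

/-- **RADIAL RIGIDITY**: a function of `‖z‖` alone, holomorphic on an open preconnected set containing a non-zero real point `t`, is constant there (identity theorem along the circle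
`|z| = |t|` through `t`).  Adapted from `YMLens.Transfer7.radial_eqOn_const`. [folklore] -/
theorem radial_eqOn_const {f : ℂ → ℂ} {h : ℝ → ℂ} (hf : ∀ z, f z = h ‖z‖) {U : Set ℂ} (hU : IsOpen U) (hUc : IsPreconnected U) (hd : DifferentiableOn ℂ f U)
    {t : ℝ} (ht : t ≠ 0) (htU : (t : ℂ) ∈ U) : EqOn f (fun _ => f t) U := by
  have hfa : AnalyticOnNhd ℂ f U := hd.analyticOnNhd hU
  have hfreq : ∃ᶠ z in 𝓝[≠] (t : ℂ), f z = f t := by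
    rw [frequently_iff]
    intro V hV
    obtain ⟨ε, hε, hεV⟩ := Metric.mem_nhdsWithin_iff.mp hV
    have hcont : Tendsto (fun δ : ℝ => (t : ℂ) * exp (δ * I)) (𝓝 0) (𝓝 ((t : ℂ) * exp ((0 : ℝ) * I))) :=
      (continuous_const.mul ((continuous_ofReal.mul continuous_const).cexp)).tendsto 0
    simp only [Complex.ofReal_zero, zero_mul, Complex.exp_zero, mul_one] at hcont
    obtain ⟨η, hη, hηε⟩ := Metric.eventually_nhds_iff.mp (Metric.tendsto_nhds.mp hcont ε hε)
    set δ : ℝ := min (η / 2) 1 with hδ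
    have hδ0 : 0 < δ := lt_min (by linarith) one_pos
    have hδη : δ < η := lt_of_le_of_lt (min_le_left _ _) (by linarith)
    have hδπ : δ < Real.pi := lt_of_le_of_lt (min_le_right _ _) (by linarith [Real.pi_gt_three])
    refine ⟨(t : ℂ) * exp (δ * I), hεV ⟨?_, ?_⟩, ?_⟩
    · exact hηε (by rw [Real.dist_eq, sub_zero, abs_of_pos hδ0]; exact hδη)
    · simp only [mem_compl_iff, mem_singleton_iff]
      intro heq
      have him := congrArg Complex.im heq
      rw [Complex.mul_im, Complex.ofReal_re, Complex.ofReal_im, zero_mul, add_zero, Complex.exp_ofReal_mul_I_im] at him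
      exact (mul_ne_zero ht (Real.sin_pos_of_pos_of_lt_pi hδ0 hδπ).ne') him
    · rw [hf, hf, norm_mul, Complex.norm_exp_ofReal_mul_I, mul_one]
  exact hfa.eqOn_of_preconnected_of_frequently_eq analyticOnNhd_const hUc htU hfreq

/-- **THE MODULUS TRAP**: a term functional reading the coupling only through its modulus — as the (2.3) thresholds of record do at complex coupling, `ResidB13K.rP := c.ε₁∕‖g‖` — and
holomorphic on the uniform-disc clause's `U` is CONSTANT in the coupling on `[0, γ]`: every physical coupling returns the zero-coupling value.  Adapted from `YMLens.Transfer7.modulusTrap`.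
[cite: Balaban1988RG2Cluster, (2.3) p.12; Balaban1987RG1, §1 p.263] -/
theorem modulusKeyed_const_of_lastDiscs {γ r : ℝ} (hγ : 0 < γ) (hr : 0 < r) {TF : ℂ → ℂ} {h : ℝ → ℂ} (hTF : ∀ z, TF z = h ‖z‖) {U : Set ℂ}
    (hdisc : ∀ t ∈ Ioc (0 : ℝ) γ, closedBall (t : ℂ) r ⊆ U) (hd : DifferentiableOn ℂ TF U) : ∀ s ∈ Icc (0 : ℝ) γ, TF s = TF 0 := by
  obtain ⟨W, hWopen, hWconv, hWU, hreal⟩ := rect_of_lastDiscs hγ hr hdisc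
  have hγW : ((γ : ℝ) : ℂ) ∈ W := hreal γ (by linarith) (by linarith)
  have hconst := radial_eqOn_const hTF hWopen hWconv.isPreconnected (hd.mono hWU) hγ.ne' hγW
  intro s hs
  have h1 : TF s = TF γ := hconst (hreal s (by linarith [hs.1]) (by linarith [hs.2]))
  have h2 : TF (0 : ℝ) = TF γ := hconst (hreal 0 (by linarith) (by linarith))
  rw [Complex.ofReal_zero] at h2
  rw [h1, ← h2]

/-- **THE THRESHOLD OF RECORD ITSELF FAILS THE CLAUSE**: `z ↦ ε₁∕‖z‖` (the small-field threshold `ε₁∕g_k` of [II] (2.3) read through the modulus) is holomorphic on NO open set containing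
the closed `r`-discs about `]0, γ]`.  Adapted from `YMLens.Transfer7.rP_not_discClause`. [cite: Balaban1988RG2Cluster, (2.3) p.12; Balaban1987RG1, (2.9) p.266] -/
theorem not_lastDiscs_invNorm {γ r ε₁ : ℝ} (hγ : 0 < γ) (hr : 0 < r) (hε : ε₁ ≠ 0) :
    ¬ ∃ U : Set ℂ, (∀ t ∈ Ioc (0 : ℝ) γ, closedBall (t : ℂ) r ⊆ U) ∧ DifferentiableOn ℂ (fun z : ℂ => ((ε₁ / ‖z‖ : ℝ) : ℂ)) U := by
  rintro ⟨U, hdisc, hd⟩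
  have h := modulusKeyed_const_of_lastDiscs hγ hr (TF := fun z : ℂ => ((ε₁ / ‖z‖ : ℝ) : ℂ)) (h := fun ρ => ((ε₁ / ρ : ℝ) : ℂ)) (fun _ => rfl) hdisc hd γ
    ⟨hγ.le, le_rfl⟩
  simp only [norm_zero, div_zero, Complex.ofReal_zero, Complex.ofReal_eq_zero, div_eq_zero_iff, Complex.norm_real, Real.norm_eq_abs, abs_eq_zero] at h
  rcases h with h1 | h2
  · exact hε h1
  · exact hγ.ne' h2

/-- **EXIT (α)**: a coupling-BLIND term meets the clause (holomorphy on `U := univ` and the uniform bound) from its real bound alone — on this exit the schema carries NO last-coupling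
content (24′ `termSchemas_zeroTermFun` is the zero instance).  Adapted from `YMLens.Transfer7.discClause_of_couplingBlind`. [cite: Balaban1987RG1, §1 p.263] -/
theorem lastDiscs_of_couplingBlind {γ r W : ℝ} (c : ℂ) (hc : ‖c‖ ≤ W) :
    ∃ U : Set ℂ, IsOpen U ∧ (∀ t ∈ Ioc (0 : ℝ) γ, closedBall (t : ℂ) r ⊆ U) ∧ DifferentiableOn ℂ (fun _ : ℂ => c) U ∧ ∀ z ∈ U, ‖(fun _ : ℂ => c) z‖ ≤ W :=
  ⟨univ, isOpen_univ, fun _ _ => subset_univ _, differentiableOn_const c, fun _ _ => hc⟩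

/-! ## §3 At the clause of 22′ `stepSchemaLast_ofTerms_of_termwise` VERBATIM (one step `k′`, one older-terms family) -/

section AtClause

variable {F : T4Family} {k : ℕ} {𝔸 : Type*} [NormedRing 𝔸] [NormedAlgebra ℂ 𝔸] [CompleteSpace 𝔸] {G : Type*} [GaugeGroup G] {M : ℕ} [NeZero M]
  {L : ℕ} [NeZero L] (TF : GenTermFun (F.P k) 𝔸 M L) (Sg : Setting 𝔸 G) (Rz : Residual (F.P k) 𝔸) (c : B13.Consts) {cs : SFConsts} {γ r E₀ κ a a₅ : ℝ}
  {k' : ℕ} (old : OlderTerms (F.P k) 𝔸 M k')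

open Classical in
/-- **(S-last-T) AS TYPED IS ANALYTICITY OF THE (2.14) TERM AT ZERO COUPLING, WITH GEOMETRIC TAYLOR BOUNDS ON `[0, γ]`.**  The hypothesis `hlastT` is the `k′`-th conjunct of 22′
`stepSchemaLast_ofTerms_of_termwise` :134 for ONE older-terms family `old` (24′ §1–§3, 25′ §1–§3 display the same shape as `hlastT`): IF `old` is (1.18)-bounded on the space tables,
then for every `X`, `φ ∈ U^c_{k′+1}(X)`, `Z ⊆ X`, `t ∈ terms L M Z` the map `z ↦ TF k′ Z t z old φ` is ANALYTIC AT `z = 0` and `‖(d∕dz)ⁿ TF …(s)‖ ≤ n!·weight(t)e^{a₅|Z|}∕(r∕2)ⁿ` at every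
`s ∈ [0, γ]` — convergent perturbation theory of the term at zero coupling, i.e. the TYPE of the `γ_k`-variant cut-off of [I] p. 266, not of possibility 1 (p. 263 «C^∞ … (or analytic)»).
[cite: Balaban1987RG1, §1 p.263 and (2.9) p.266; Balaban1988RG2Cluster, (2.14) p.15 and (2.26) p.17] -/
theorem analyticAt_zero_of_stepSchemaLastT (hγ : 0 < γ) (hr : 0 < r)
    (hlastT : ∃ U : Set ℂ, IsOpen U ∧ (∀ t ∈ Ioc (0 : ℝ) γ, closedBall (t : ℂ) r ⊆ U) ∧
      ((∀ (j : Fin (k' + 1)) (Y : (domSys (F.P k) M j).Dom) (ψ : CPair (F.P k) 𝔸), ψ ∈ spaceI Sg Rz M j (domSites (F.P k) M j Y) cs.α₀ cs.α₁ →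
          ‖old j Y ψ‖ ≤ E₀ * Real.exp (-(κ * torusTreeLen Y.1))) →
        ∀ (X : (domSys (F.P k) M (k' + 1)).Dom) (φ : CPair (F.P k) 𝔸), φ ∈ spaceI Sg Rz M (k' + 1) (domSites (F.P k) M (k' + 1) X) cs.α₀ cs.α₁ →
          ∀ (Z : (domSys (F.P k) M (k' + 1)).Dom), Z.1 ⊆ X.1 → ∀ t ∈ terms L M Z,
            DifferentiableOn ℂ (fun z => TF k' Z t z old φ) U ∧ ∀ z ∈ U, ‖TF k' Z t z old φ‖ ≤ weight L M c Z a t * Real.exp (a₅ * ((Z.1).card : ℝ))))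
    (hold : ∀ (j : Fin (k' + 1)) (Y : (domSys (F.P k) M j).Dom) (ψ : CPair (F.P k) 𝔸), ψ ∈ spaceI Sg Rz M j (domSites (F.P k) M j Y) cs.α₀ cs.α₁ →
      ‖old j Y ψ‖ ≤ E₀ * Real.exp (-(κ * torusTreeLen Y.1)))
    (X : (domSys (F.P k) M (k' + 1)).Dom) (φ : CPair (F.P k) 𝔸) (hφ : φ ∈ spaceI Sg Rz M (k' + 1) (domSites (F.P k) M (k' + 1) X) cs.α₀ cs.α₁)
    (Z : (domSys (F.P k) M (k' + 1)).Dom) (hZ : Z.1 ⊆ X.1) (t : Finset (TDom 4 (L * domCount (F.P k) M (k' + 1))) × Finset (TBond 4 M (L * domCount (F.P k) M (k' + 1))))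
    (ht : t ∈ terms L M Z) :
    AnalyticAt ℂ (fun z => TF k' Z t z old φ) 0 ∧
      ∀ s ∈ Icc (0 : ℝ) γ, ∀ n : ℕ, ‖iteratedDeriv n (fun z => TF k' Z t z old φ) s‖ ≤ n.factorial * (weight L M c Z a t * Real.exp (a₅ * ((Z.1).card : ℝ))) / (r / 2) ^ n := by
  obtain ⟨U, -, hdisc, hcond⟩ := hlastT
  obtain ⟨hhol, hbd⟩ := hcond hold X φ hφ Z hZ t ht
  exact ⟨analyticAt_zero_of_lastDiscs hγ hr hdisc hhol, taylorBound_of_lastDiscs hγ hr hdisc hhol hbd⟩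

open Classical in
/-- **(S-last-T) FREEZES EVERY THRESHOLD LAW OF THE TERM.**  If the term reads its last coupling only through a real threshold law `ρ` and a strictly monotone real response `Gm` —
`TF k′ Z t s old φ = Gm (ρ s)` for all `s` (the (2.3) ∕ (2.22) keying of record: `ρ s = ε₁∕‖s‖`, `Gm` a box mass) — then under `hlastT` (premise met) `ρ` is CONSTANT on `[0, γ]`:
the thresholds `ε₁∕g_k` cannot ride on any term functional meeting the schema, under any complexification of the coupling. [cite: Balaban1988RG2Cluster, (2.3) p.12 and (2.22) p.16; Balaban1987RG1, §1 p.263 and (2.9) p.266] -/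
theorem thresholdLaw_frozen_of_stepSchemaLastT (hγ : 0 < γ) (hr : 0 < r)
    (hlastT : ∃ U : Set ℂ, IsOpen U ∧ (∀ t ∈ Ioc (0 : ℝ) γ, closedBall (t : ℂ) r ⊆ U) ∧
      ((∀ (j : Fin (k' + 1)) (Y : (domSys (F.P k) M j).Dom) (ψ : CPair (F.P k) 𝔸), ψ ∈ spaceI Sg Rz M j (domSites (F.P k) M j Y) cs.α₀ cs.α₁ →
          ‖old j Y ψ‖ ≤ E₀ * Real.exp (-(κ * torusTreeLen Y.1))) →
        ∀ (X : (domSys (F.P k) M (k' + 1)).Dom) (φ : CPair (F.P k) 𝔸), φ ∈ spaceI Sg Rz M (k' + 1) (domSites (F.P k) M (k' + 1) X) cs.α₀ cs.α₁ →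
          ∀ (Z : (domSys (F.P k) M (k' + 1)).Dom), Z.1 ⊆ X.1 → ∀ t ∈ terms L M Z,
            DifferentiableOn ℂ (fun z => TF k' Z t z old φ) U ∧ ∀ z ∈ U, ‖TF k' Z t z old φ‖ ≤ weight L M c Z a t * Real.exp (a₅ * ((Z.1).card : ℝ))))
    (hold : ∀ (j : Fin (k' + 1)) (Y : (domSys (F.P k) M j).Dom) (ψ : CPair (F.P k) 𝔸), ψ ∈ spaceI Sg Rz M j (domSites (F.P k) M j Y) cs.α₀ cs.α₁ →
      ‖old j Y ψ‖ ≤ E₀ * Real.exp (-(κ * torusTreeLen Y.1)))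
    (X : (domSys (F.P k) M (k' + 1)).Dom) (φ : CPair (F.P k) 𝔸) (hφ : φ ∈ spaceI Sg Rz M (k' + 1) (domSites (F.P k) M (k' + 1) X) cs.α₀ cs.α₁)
    (Z : (domSys (F.P k) M (k' + 1)).Dom) (hZ : Z.1 ⊆ X.1) (t : Finset (TDom 4 (L * domCount (F.P k) M (k' + 1))) × Finset (TBond 4 M (L * domCount (F.P k) M (k' + 1))))
    (ht : t ∈ terms L M Z) {ρ : ℂ → ℝ} {Gm : ℝ → ℝ} (hGm : StrictMono Gm) (hlaw : ∀ s : ℂ, TF k' Z t s old φ = ((Gm (ρ s) : ℝ) : ℂ)) :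
    ∀ s ∈ Icc (0 : ℝ) γ, ρ s = ρ 0 := by
  obtain ⟨U, -, hdisc, hcond⟩ := hlastT
  exact thresholdLaw_frozen_of_lastDiscs hγ hr hGm hlaw hdisc (hcond hold X φ hφ Z hZ t ht).1

open Classical in
/-- **(S-last-T) TRAPS A MODULUS-KEYED TERM AT ITS ZERO-COUPLING VALUE.**  If the term reads its last coupling only through the modulus — `TF k′ Z t z old φ = h ‖z‖` (the complexification
`g := z` of a term whose thresholds are `c.ε₁∕‖g‖`, def-B13's `ResidB13K.rP`) — then under `hlastT` (premise met) it is CONSTANT in the coupling on `[0, γ]`.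
[cite: Balaban1988RG2Cluster, (2.3) p.12; Balaban1987RG1, §1 p.263 and (2.13) p.268] -/
theorem modulusKeyed_const_of_stepSchemaLastT (hγ : 0 < γ) (hr : 0 < r)
    (hlastT : ∃ U : Set ℂ, IsOpen U ∧ (∀ t ∈ Ioc (0 : ℝ) γ, closedBall (t : ℂ) r ⊆ U) ∧
      ((∀ (j : Fin (k' + 1)) (Y : (domSys (F.P k) M j).Dom) (ψ : CPair (F.P k) 𝔸), ψ ∈ spaceI Sg Rz M j (domSites (F.P k) M j Y) cs.α₀ cs.α₁ →
          ‖old j Y ψ‖ ≤ E₀ * Real.exp (-(κ * torusTreeLen Y.1))) →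
        ∀ (X : (domSys (F.P k) M (k' + 1)).Dom) (φ : CPair (F.P k) 𝔸), φ ∈ spaceI Sg Rz M (k' + 1) (domSites (F.P k) M (k' + 1) X) cs.α₀ cs.α₁ →
          ∀ (Z : (domSys (F.P k) M (k' + 1)).Dom), Z.1 ⊆ X.1 → ∀ t ∈ terms L M Z,
            DifferentiableOn ℂ (fun z => TF k' Z t z old φ) U ∧ ∀ z ∈ U, ‖TF k' Z t z old φ‖ ≤ weight L M c Z a t * Real.exp (a₅ * ((Z.1).card : ℝ))))
    (hold : ∀ (j : Fin (k' + 1)) (Y : (domSys (F.P k) M j).Dom) (ψ : CPair (F.P k) 𝔸), ψ ∈ spaceI Sg Rz M j (domSites (F.P k) M j Y) cs.α₀ cs.α₁ →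
      ‖old j Y ψ‖ ≤ E₀ * Real.exp (-(κ * torusTreeLen Y.1)))
    (X : (domSys (F.P k) M (k' + 1)).Dom) (φ : CPair (F.P k) 𝔸) (hφ : φ ∈ spaceI Sg Rz M (k' + 1) (domSites (F.P k) M (k' + 1) X) cs.α₀ cs.α₁)
    (Z : (domSys (F.P k) M (k' + 1)).Dom) (hZ : Z.1 ⊆ X.1) (t : Finset (TDom 4 (L * domCount (F.P k) M (k' + 1))) × Finset (TBond 4 M (L * domCount (F.P k) M (k' + 1))))
    (ht : t ∈ terms L M Z) {h : ℝ → ℂ} (hmod : ∀ z : ℂ, TF k' Z t z old φ = h ‖z‖) :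
    ∀ s ∈ Icc (0 : ℝ) γ, TF k' Z t s old φ = TF k' Z t 0 old φ := by
  obtain ⟨U, -, hdisc, hcond⟩ := hlastT
  exact modulusKeyed_const_of_lastDiscs hγ hr hmod hdisc (hcond hold X φ hφ Z hZ t ht).1

end AtClause

end YMDAG.N22.W1

end
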